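import Literature.NumberTheory.PAdicHodge.BdRPlusGaloisContinuity
import Literature.NumberTheory.PAdicHodge.BdRPlusLog
import Literature.NumberTheory.PAdicHodge.TateH1BdRFil
import Literature.NumberTheory.PAdicHodge.BdRDevissageInputs
import Literature.NumberTheory.PAdicHodge.TateGradedDevissage
import HarnessLib

/-!
# `H¹(Γ_F, B^m_dR) = F · log χ` / `0` on cocycles of finite type (Kato II §1.2.7, `V = ℚ_p`), GRANTED (TS1)

Topic `Literature/NumberTheory/PAdicHodge`; THEOREMS ONLY (no definition, no named fact, no instance,
no `sorry`). This file DISCHARGES the named fact `kato1993_H1_bdRFil` (file `TateH1BdRFil`; Kato, LNM 1553,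
II §1.2.7 for `V = ℚ_p`, read on cocycles of finite type) modulo the single named fact
`tate1967_TS1_completedAlgClosure` (Tate 1967 §3.2 Prop. 9 / Berger–Colmez (TS1)):

  `kato1993_H1_bdRFil_of_TS1 : tate1967_TS1_completedAlgClosure → kato1993_H1_bdRFil`.

Proof = Kato's `t`-adic dévissage (tree `TateGraded.exists_eq_coboundary_add_of_devissage`) for Fontaine's
`B_dR(F)` with the continuity predicate on cochains `c : Γ_F → Fil^N B_dR`

  `Cts N c :⟺ ∃ z : Γ_F → B_dR⁺, c = t^N · z and z is continuous for Fontaine's topology`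

(`t = log[ε]`, `σ t = χ(σ) t`; continuity = `∀ N k, ∃ U open, ∀ σ, ∀ τ ∈ U, z(στ) − z(σ) ∈ p^N ι(𝔸_inf) + ξ^k B_dR⁺`,
file `BdRPlusGaloisContinuity` and Part I below). The four hypotheses of the dévissage:
`hcomplete`, `hgrne`, `hgrz` are the tree's `BdRDevissageInputs` (the latter two modulo (TS1), through the
continuity of `θ ∘ z`), and **`hstep`** — stability of `Cts` under `c ↦ c − ∂y − log χ · a` — is proved here
(§2) from the continuity of the `Γ_F`-action on `B_dR⁺` (`t^{-N}(σ y − y) = χ(σ)^N σ(y₀) − y₀` for `y = t^N y₀`)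
and division by `t`. Cocycles of finite type `Σ_j f_j(σ) β_j` are `Cts` (§3). Consequence (§4): Kato II Prop.
1.2.3 (`hasDualExp_of_isDeRham`, both halves) for every de Rham `V` holds modulo (TS1) alone.
BSD is not proved by any of this.

## References
* K. Kato, LNM 1553 (1993), Ch. II §1.2.5–1.2.7 and Prop. 1.2.3. [Kato1993LNM1553]
* J. Tate, *p-divisible groups* (1967), §3.2 Prop. 9, §3.3 Theorems 1–2. [Tate1967]
* J.-M. Fontaine, *Le corps des périodes p-adiques*, Astérisque 223 (1994), Exp. II §1.5. [FontaineAsterisque223III]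
-/

/-! # Part I — continuous cochains `Γ_F → B_dR⁺(F)` (closure properties, `θ`-projection) -/
/-!
# Continuous cochains `Γ_F → B_dR⁺(F)` for Fontaine's topology: closure properties and the `θ`-projection

Topic `Literature/NumberTheory/PAdicHodge`; THEOREMS ONLY (no definition, no named fact, no instance,
no `sorry`). Part I, sequel to `BdRPlusGaloisContinuity`. Kato (LNM 1553, II §1.2.5–1.2.7) computes
`H¹(K, B^m_dR)` with CONTINUOUS cochains for the topology of `B_dR⁺/Fil^k = (𝔸_inf/ξ^k)[1/p]`. In the
tree's def-free currency a cochain `z : Γ_F → B_dR⁺` is (uniformly) continuous when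

  `∀ N k, ∃ U ≤ Γ_F open, ∀ σ, ∀ τ ∈ U, z(στ) − z(σ) ∈ Λ(N, k) = p^N ι(𝔸_inf) + ξ^k B_dR⁺`

(displayed as `∃ a w, z(στ) − z(σ) = ι(p^N a) + ξ^k w`). This file proves the closure properties of this
class needed by the `t`-adic dévissage (tree `TateGraded.exists_eq_coboundary_add_of_devissage`, hypothesis
`hstep`): orbit maps `σ ↦ σ y₀` (§1, from the continuity of the action), sums and fixed multiples (§2),
products with continuous scalar functions `Γ_F → ℚ_p` (§3), division by `ξ` and by `t` (§4), and the
continuity of `θ ∘ z : Γ_F → ℂ_F` (§5, the `θ`-link to Tate's `ℂ_F`-level theorems). BSD is not proved here.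

## References
* K. Kato, LNM 1553 (1993), Ch. II §1.2.5–1.2.7. [Kato1993LNM1553]
* J.-M. Fontaine, *Le corps des périodes p-adiques*, Astérisque 223 (1994), Exp. II §1.5.3–1.5.5. [FontaineAsterisque223III]
-/

noncomputable section

open ValuativeRel Field Ideal WittVector Topology Filter

namespace Literature.NumberTheory.PAdicHodge

open Literature.NumberTheory.GaloisRepresentations
open Literature.NumberTheory.GaloisRepresentations.IsNonarchimedeanLocalField

namespace GaloisContinuity

variable {F : Type} [Field F] [ValuativeRel F] [TopologicalSpace F] [IsNonarchimedeanLocalField F]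
  [CharZero F] {p : ℕ} [Fact p.Prime] [Fact (¬ IsUnit (p : integerC F))]
  [IsAdicComplete (Ideal.span {(p : integerC F)}) (integerC F)]

/-! ## §1 Orbit maps and constants -/

/-- **The orbit map `σ ↦ σ y₀` is a continuous cochain** (continuity of the action of `Γ_F` on `B_dR⁺`).
[cite: FontaineAsterisque223III, Exp. II §1.5.3–1.5.5] [cite: Kato1993LNM1553, Ch. II §1.2.5] -/
theorem uc_galBdRPlus (y₀ : BDeRhamPlus (integerC F) p) :
    ∀ N k : ℕ, ∃ U : OpenSubgroup (absoluteGaloisGroup F), ∀ σ : absoluteGaloisGroup F, ∀ τ ∈ U,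
      ∃ (a : Ainf (p := p) F) (w : BDeRhamPlus (integerC F) p),
        galBdRPlus (σ * τ) y₀ - galBdRPlus σ y₀ = ainfToBdR ((p : Ainf (p := p) F) ^ N * a) + xiBdR ^ k * w :=
  fun N k => exists_openSubgroup_galBdRPlus_mul_sub_mem y₀ N k

omit [CharZero F] in
/-- A constant cochain is continuous. [cite: Kato1993LNM1553, Ch. II §1.2.5] -/
theorem uc_const (b : BDeRhamPlus (integerC F) p) :
    ∀ N k : ℕ, ∃ U : OpenSubgroup (absoluteGaloisGroup F), ∀ σ : absoluteGaloisGroup F, ∀ τ ∈ U,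
      ∃ (a : Ainf (p := p) F) (w : BDeRhamPlus (integerC F) p),
        (fun _ => b) (σ * τ) - (fun _ => b) σ = ainfToBdR ((p : Ainf (p := p) F) ^ N * a) + xiBdR ^ k * w :=
  fun N k => ⟨⊤, fun σ τ _ => ⟨0, 0, by simp⟩⟩

/-- **The orbit map is uniformly bounded**: `p^r · σ(y₀) ∈ ι(𝔸_inf) + ξ^k B_dR⁺` with `r` independent of `σ`
(`σ` preserves `ι(𝔸_inf)` and `(ξ)`). [cite: FontaineAsterisque223III, Exp. II §1.5.3–1.5.5] -/
theorem bounded_galBdRPlus (y₀ : BDeRhamPlus (integerC F) p) (k : ℕ) :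
    ∃ r : ℕ, ∀ σ : absoluteGaloisGroup F, ∃ (a : Ainf (p := p) F) (w : BDeRhamPlus (integerC F) p),
      (p : BDeRhamPlus (integerC F) p) ^ r * galBdRPlus σ y₀ = ainfToBdR a + xiBdR ^ k * w := by
  obtain ⟨r, a₀, w₀, h⟩ := exists_natCast_pow_mul_eq_ainfToBdR_add y₀ k
  refine ⟨r, fun σ => ?_⟩
  obtain ⟨w', hw'⟩ := exists_galBdRPlus_xiBdR_pow_mul σ k w₀
  refine ⟨galAinf σ a₀, w', ?_⟩
  have h1 := congrArg (galBdRPlus σ) h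
  rwa [map_mul, map_pow, map_natCast, map_add, galBdRPlus_ainfToBdR, hw'] at h1

/-! ## §2 Sums, differences, fixed multiples -/

omit [CharZero F] in
/-- **Sums of continuous cochains are continuous.** [cite: Kato1993LNM1553, Ch. II §1.2.5] -/
theorem uc_add {z₁ z₂ : absoluteGaloisGroup F → BDeRhamPlus (integerC F) p}
    (h₁ : ∀ N k : ℕ, ∃ U : OpenSubgroup (absoluteGaloisGroup F), ∀ σ : absoluteGaloisGroup F, ∀ τ ∈ U,
      ∃ (a : Ainf (p := p) F) (w : BDeRhamPlus (integerC F) p),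
        z₁ (σ * τ) - z₁ σ = ainfToBdR ((p : Ainf (p := p) F) ^ N * a) + xiBdR ^ k * w)
    (h₂ : ∀ N k : ℕ, ∃ U : OpenSubgroup (absoluteGaloisGroup F), ∀ σ : absoluteGaloisGroup F, ∀ τ ∈ U,
      ∃ (a : Ainf (p := p) F) (w : BDeRhamPlus (integerC F) p),
        z₂ (σ * τ) - z₂ σ = ainfToBdR ((p : Ainf (p := p) F) ^ N * a) + xiBdR ^ k * w) :
    ∀ N k : ℕ, ∃ U : OpenSubgroup (absoluteGaloisGroup F), ∀ σ : absoluteGaloisGroup F, ∀ τ ∈ U,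
      ∃ (a : Ainf (p := p) F) (w : BDeRhamPlus (integerC F) p),
        (z₁ (σ * τ) + z₂ (σ * τ)) - (z₁ σ + z₂ σ) = ainfToBdR ((p : Ainf (p := p) F) ^ N * a) + xiBdR ^ k * w := by
  intro N k
  obtain ⟨U₁, hU₁⟩ := h₁ N k
  obtain ⟨U₂, hU₂⟩ := h₂ N k
  refine ⟨U₁ ⊓ U₂, fun σ τ hτ => ?_⟩
  obtain ⟨a, w, haw⟩ := hU₁ σ τ (OpenSubgroup.mem_inf.1 hτ).1
  obtain ⟨b, v, hbv⟩ := hU₂ σ τ (OpenSubgroup.mem_inf.1 hτ).2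
  refine ⟨a + b, w + v, ?_⟩
  rw [← lattice_add haw hbv]
  ring

omit [CharZero F] in
/-- **Differences of continuous cochains are continuous.** [cite: Kato1993LNM1553, Ch. II §1.2.5] -/
theorem uc_sub {z₁ z₂ : absoluteGaloisGroup F → BDeRhamPlus (integerC F) p}
    (h₁ : ∀ N k : ℕ, ∃ U : OpenSubgroup (absoluteGaloisGroup F), ∀ σ : absoluteGaloisGroup F, ∀ τ ∈ U,
      ∃ (a : Ainf (p := p) F) (w : BDeRhamPlus (integerC F) p),
        z₁ (σ * τ) - z₁ σ = ainfToBdR ((p : Ainf (p := p) F) ^ N * a) + xiBdR ^ k * w)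
    (h₂ : ∀ N k : ℕ, ∃ U : OpenSubgroup (absoluteGaloisGroup F), ∀ σ : absoluteGaloisGroup F, ∀ τ ∈ U,
      ∃ (a : Ainf (p := p) F) (w : BDeRhamPlus (integerC F) p),
        z₂ (σ * τ) - z₂ σ = ainfToBdR ((p : Ainf (p := p) F) ^ N * a) + xiBdR ^ k * w) :
    ∀ N k : ℕ, ∃ U : OpenSubgroup (absoluteGaloisGroup F), ∀ σ : absoluteGaloisGroup F, ∀ τ ∈ U,
      ∃ (a : Ainf (p := p) F) (w : BDeRhamPlus (integerC F) p),
        (z₁ (σ * τ) - z₂ (σ * τ)) - (z₁ σ - z₂ σ) = ainfToBdR ((p : Ainf (p := p) F) ^ N * a) + xiBdR ^ k * w := by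
  intro N k
  obtain ⟨U₁, hU₁⟩ := h₁ N k
  obtain ⟨U₂, hU₂⟩ := h₂ N k
  refine ⟨U₁ ⊓ U₂, fun σ τ hτ => ?_⟩
  obtain ⟨a, w, haw⟩ := hU₁ σ τ (OpenSubgroup.mem_inf.1 hτ).1
  obtain ⟨b, v, hbv⟩ := hU₂ σ τ (OpenSubgroup.mem_inf.1 hτ).2
  refine ⟨a - b, w - v, ?_⟩
  rw [← lattice_sub haw hbv]
  ring

/-- **A fixed multiple `b · z` of a continuous cochain is continuous** (every `b ∈ B_dR⁺` is bounded).
[cite: FontaineAsterisque223III, Exp. II §1.5.3] [cite: Kato1993LNM1553, Ch. II §1.2.5] -/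
theorem uc_mul_left (b : BDeRhamPlus (integerC F) p) {z : absoluteGaloisGroup F → BDeRhamPlus (integerC F) p}
    (h : ∀ N k : ℕ, ∃ U : OpenSubgroup (absoluteGaloisGroup F), ∀ σ : absoluteGaloisGroup F, ∀ τ ∈ U,
      ∃ (a : Ainf (p := p) F) (w : BDeRhamPlus (integerC F) p),
        z (σ * τ) - z σ = ainfToBdR ((p : Ainf (p := p) F) ^ N * a) + xiBdR ^ k * w) :
    ∀ N k : ℕ, ∃ U : OpenSubgroup (absoluteGaloisGroup F), ∀ σ : absoluteGaloisGroup F, ∀ τ ∈ U,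
      ∃ (a : Ainf (p := p) F) (w : BDeRhamPlus (integerC F) p),
        b * z (σ * τ) - b * z σ = ainfToBdR ((p : Ainf (p := p) F) ^ N * a) + xiBdR ^ k * w := by
  intro N k
  obtain ⟨r, ab, wb, hb⟩ := exists_natCast_pow_mul_eq_ainfToBdR_add b k
  obtain ⟨U, hU⟩ := h (N + r) k
  refine ⟨U, fun σ τ hτ => ?_⟩
  obtain ⟨a, w, haw⟩ := hU σ τ hτ
  rw [← mul_sub]
  exact lattice_mul_of_bounded hb haw

omit [CharZero F] in
/-- **Finite sums of continuous cochains are continuous.** [cite: Kato1993LNM1553, Ch. II §1.2.5] -/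
theorem uc_sum {ι : Type} (s : Finset ι) {z : ι → absoluteGaloisGroup F → BDeRhamPlus (integerC F) p}
    (h : ∀ j ∈ s, ∀ N k : ℕ, ∃ U : OpenSubgroup (absoluteGaloisGroup F), ∀ σ : absoluteGaloisGroup F, ∀ τ ∈ U,
      ∃ (a : Ainf (p := p) F) (w : BDeRhamPlus (integerC F) p),
        z j (σ * τ) - z j σ = ainfToBdR ((p : Ainf (p := p) F) ^ N * a) + xiBdR ^ k * w) :
    ∀ N k : ℕ, ∃ U : OpenSubgroup (absoluteGaloisGroup F), ∀ σ : absoluteGaloisGroup F, ∀ τ ∈ U,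
      ∃ (a : Ainf (p := p) F) (w : BDeRhamPlus (integerC F) p),
        (∑ j ∈ s, z j (σ * τ)) - (∑ j ∈ s, z j σ) = ainfToBdR ((p : Ainf (p := p) F) ^ N * a) + xiBdR ^ k * w := by
  classical
  induction s using Finset.induction_on with
  | empty => intro N k; exact ⟨⊤, fun σ τ _ => ⟨0, 0, by simp⟩⟩
  | insert j s hj ih =>
    have hz := h j (Finset.mem_insert_self j s)
    have hs := ih fun i hi => h i (Finset.mem_insert_of_mem hi)
    intro N k
    obtain ⟨U, hU⟩ := uc_add hz hs N k
    refine ⟨U, fun σ τ hτ => ?_⟩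
    rw [Finset.sum_insert hj, Finset.sum_insert hj]
    exact hU σ τ hτ

/-! ## §3 Products with continuous scalar functions `Γ_F → ℚ_p` -/

omit [CharZero F] in
/-- A scalar of norm `≤ p^s` times an element of `Λ(N + s, k)` lies in `Λ(N, k)`. [cite: FontaineAsterisque223III, Exp. II §1.5.3] -/
theorem lattice_qpToBdR_mul_of_norm_le {x : BDeRhamPlus (integerC F) p} {N k s : ℕ} {a : Ainf (p := p) F}
    {w : BDeRhamPlus (integerC F) p} {δ : ℚ_[p]} (hδ : ‖δ‖ ≤ (p : ℝ) ^ s)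
    (hx : x = ainfToBdR ((p : Ainf (p := p) F) ^ (N + s) * a) + xiBdR ^ k * w) :
    ∃ (a' : Ainf (p := p) F) (w' : BDeRhamPlus (integerC F) p),
      qpToBdR δ * x = ainfToBdR ((p : Ainf (p := p) F) ^ N * a') + xiBdR ^ k * w' := by
  have hp0 : (p : ℚ_[p]) ≠ 0 := Nat.cast_ne_zero.2 (Fact.out : p.Prime).ne_zero
  -- `δ = p^{-s} g`, `g ∈ ℤ_p`
  have hp0' : (p : ℝ) ≠ 0 := Nat.cast_ne_zero.2 (Fact.out : p.Prime).ne_zero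
  have hg : ‖δ * (p : ℚ_[p]) ^ s‖ ≤ 1 := by
    rw [norm_mul, Padic.norm_p_pow]
    calc ‖δ‖ * (p : ℝ) ^ (-(s : ℤ)) ≤ (p : ℝ) ^ s * (p : ℝ) ^ (-(s : ℤ)) :=
          mul_le_mul_of_nonneg_right hδ (zpow_nonneg (Nat.cast_nonneg _) _)
      _ = 1 := by rw [← zpow_natCast, ← zpow_add₀ hp0', add_neg_cancel, zpow_zero]
  set g : ℤ_[p] := ⟨δ * (p : ℚ_[p]) ^ s, hg⟩ with hgdef
  have hδg : qpToBdR δ * (p : BDeRhamPlus (integerC F) p) ^ s = qpToBdR (g : ℚ_[p]) := by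
    change qpToBdR δ * (p : BDeRhamPlus (integerC F) p) ^ s = qpToBdR (δ * (p : ℚ_[p]) ^ s)
    rw [map_mul, map_pow, map_natCast]
  refine ⟨zpToAinf g * a, qpToBdR δ * w, ?_⟩
  have h1 : qpToBdR δ * ainfToBdR ((p : Ainf (p := p) F) ^ (N + s) * a) =
      (qpToBdR δ * (p : BDeRhamPlus (integerC F) p) ^ s) * ainfToBdR ((p : Ainf (p := p) F) ^ N * a) := by
    simp only [pow_add, map_mul, map_pow, map_natCast]; ring
  rw [hx, mul_add, h1, hδg, qpToBdR_coe]
  simp only [map_mul, map_pow, map_natCast]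
  ring

/-- **A continuous scalar function times a bounded continuous cochain is continuous**: for
`f : Γ_F → ℚ_p` continuous and `y : Γ_F → B_dR⁺` continuous with a uniform bound
`p^r y(σ) ∈ ι(𝔸_inf) + ξ^k B_dR⁺`, the cochain `σ ↦ f(σ) · y(σ)` is continuous (continuity of the scalar
multiplication `ℚ_p × B_dR⁺ → B_dR⁺`; `f` is bounded and uniformly continuous on the compact `Γ_F`).
[cite: Kato1993LNM1553, Ch. II §1.2.5] [cite: FontaineAsterisque223III, Exp. II §1.5.3] -/
theorem uc_qpToBdR_mul {f : absoluteGaloisGroup F → ℚ_[p]} (hf : Continuous f)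
    {y : absoluteGaloisGroup F → BDeRhamPlus (integerC F) p}
    (hy : ∀ N k : ℕ, ∃ U : OpenSubgroup (absoluteGaloisGroup F), ∀ σ : absoluteGaloisGroup F, ∀ τ ∈ U,
      ∃ (a : Ainf (p := p) F) (w : BDeRhamPlus (integerC F) p),
        y (σ * τ) - y σ = ainfToBdR ((p : Ainf (p := p) F) ^ N * a) + xiBdR ^ k * w)
    (hyb : ∀ k : ℕ, ∃ r : ℕ, ∀ σ : absoluteGaloisGroup F, ∃ (a : Ainf (p := p) F) (w : BDeRhamPlus (integerC F) p),
      (p : BDeRhamPlus (integerC F) p) ^ r * y σ = ainfToBdR a + xiBdR ^ k * w) :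
    ∀ N k : ℕ, ∃ U : OpenSubgroup (absoluteGaloisGroup F), ∀ σ : absoluteGaloisGroup F, ∀ τ ∈ U,
      ∃ (a : Ainf (p := p) F) (w : BDeRhamPlus (integerC F) p),
        qpToBdR (f (σ * τ)) * y (σ * τ) - qpToBdR (f σ) * y σ =
          ainfToBdR ((p : Ainf (p := p) F) ^ N * a) + xiBdR ^ k * w := by
  intro N k
  -- `f` is bounded by `p^s`
  obtain ⟨C, hC⟩ : ∃ C : ℝ, ∀ σ, ‖f σ‖ ≤ C := by
    obtain ⟨C, hC⟩ := isCompact_univ.exists_bound_of_continuousOn (f := f) hf.continuousOn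
    exact ⟨C, fun σ => hC σ (Set.mem_univ σ)⟩
  obtain ⟨s, hs⟩ := pow_unbounded_of_one_lt C (by exact_mod_cast (Fact.out : p.Prime).one_lt : (1 : ℝ) < p)
  -- bound `r` for `y` and the two open subgroups
  obtain ⟨r, hr⟩ := hyb k
  obtain ⟨U₁, hU₁⟩ := hy (N + s) k
  obtain ⟨U₂, hU₂⟩ := exists_openSubgroup_sub_eq_natCast_pow_mul hf (N + r)
  refine ⟨U₁ ⊓ U₂, fun σ τ hτ => ?_⟩
  obtain ⟨a₁, w₁, h₁⟩ := hU₁ σ τ (OpenSubgroup.mem_inf.1 hτ).1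
  obtain ⟨g, hg⟩ := hU₂ σ τ (OpenSubgroup.mem_inf.1 hτ).2
  obtain ⟨a₂, w₂, h₂⟩ := hr σ
  -- first term: `f(στ) · (y(στ) − y(σ))`
  obtain ⟨a₃, w₃, h₃⟩ := lattice_qpToBdR_mul_of_norm_le ((hC (σ * τ)).trans hs.le) h₁
  -- second term: `(f(στ) − f(σ)) · y(σ)`
  obtain ⟨a₄, w₄, h₄⟩ := lattice_smul_of_bounded h₂ hg
  refine ⟨a₃ + a₄, w₃ + w₄, ?_⟩
  rw [← lattice_add h₃ h₄, map_sub]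
  ring

/-! ## §4 Division by `ξ` and by `t` -/

/-- **Division by `ξ` preserves continuity**: if `w = ξ · z` pointwise and `w` is continuous then so is `z`
(`ξ B_dR⁺ ∩ Λ(N, k+1) = ξ Λ(N, k)`: multiplication by `ξ` is a closed embedding for Fontaine's topology).
[cite: FontaineAsterisque223III, Exp. II §1.5.3–1.5.5] [cite: Kato1993LNM1553, Ch. II §1.2.5–1.2.6] -/
theorem uc_of_xiBdR_mul {w z : absoluteGaloisGroup F → BDeRhamPlus (integerC F) p}
    (hw : ∀ N k : ℕ, ∃ U : OpenSubgroup (absoluteGaloisGroup F), ∀ σ : absoluteGaloisGroup F, ∀ τ ∈ U,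
      ∃ (a : Ainf (p := p) F) (v : BDeRhamPlus (integerC F) p),
        w (σ * τ) - w σ = ainfToBdR ((p : Ainf (p := p) F) ^ N * a) + xiBdR ^ k * v)
    (hwz : ∀ σ, w σ = xiBdR * z σ) :
    ∀ N k : ℕ, ∃ U : OpenSubgroup (absoluteGaloisGroup F), ∀ σ : absoluteGaloisGroup F, ∀ τ ∈ U,
      ∃ (a : Ainf (p := p) F) (v : BDeRhamPlus (integerC F) p),
        z (σ * τ) - z σ = ainfToBdR ((p : Ainf (p := p) F) ^ N * a) + xiBdR ^ k * v := by
  intro N k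
  obtain ⟨U, hU⟩ := hw N (k + 1)
  refine ⟨U, fun σ τ hτ => ?_⟩
  obtain ⟨a, v, hav⟩ := hU σ τ hτ
  rw [hwz, hwz, ← mul_sub] at hav
  exact exists_eq_of_xiBdR_mul_eq_natCast_pow hav

/-- **Division by Fontaine's `t` preserves continuity** (`t = ξ · unit`). [cite: FontaineAsterisque223III, Exp. II §1.5.4–1.5.5] -/
theorem uc_of_tBdR_mul (hF : Function.Surjective (fontaineTheta (integerC F) p))
    {w z : absoluteGaloisGroup F → BDeRhamPlus (integerC F) p}
    (hw : ∀ N k : ℕ, ∃ U : OpenSubgroup (absoluteGaloisGroup F), ∀ σ : absoluteGaloisGroup F, ∀ τ ∈ U,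
      ∃ (a : Ainf (p := p) F) (v : BDeRhamPlus (integerC F) p),
        w (σ * τ) - w σ = ainfToBdR ((p : Ainf (p := p) F) ^ N * a) + xiBdR ^ k * v)
    (hwz : ∀ σ, w σ = tBdR * z σ) :
    ∀ N k : ℕ, ∃ U : OpenSubgroup (absoluteGaloisGroup F), ∀ σ : absoluteGaloisGroup F, ∀ τ ∈ U,
      ∃ (a : Ainf (p := p) F) (v : BDeRhamPlus (integerC F) p),
        z (σ * τ) - z σ = ainfToBdR ((p : Ainf (p := p) F) ^ N * a) + xiBdR ^ k * v := by
  obtain ⟨u, hu, htu⟩ := exists_tBdR_eq_xiBdR_mul (F := F) (p := p) hF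
  -- `w = ξ · (u z)`, so `u z` is continuous, hence `z = u⁻¹ (u z)` is
  have h1 := uc_of_xiBdR_mul (z := fun σ => u * z σ) hw (fun σ => by rw [hwz, htu, mul_assoc])
  have h2 := uc_mul_left ((hu.unit⁻¹ : (BDeRhamPlus (integerC F) p)ˣ) : BDeRhamPlus (integerC F) p) h1
  have h3 : ∀ σ, ((hu.unit⁻¹ : (BDeRhamPlus (integerC F) p)ˣ) : BDeRhamPlus (integerC F) p) * (u * z σ) = z σ :=
    fun σ => by rw [← mul_assoc, IsUnit.val_inv_mul, one_mul]
  simpa only [h3] using h2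

/-! ## §5 The `θ`-projection of a continuous cochain is continuous -/

/-- **`θ ∘ z : Γ_F → ℂ_F` is continuous** for a continuous cochain `z : Γ_F → B_dR⁺` (`θ(Λ(N,1)) ⊆ p^N 𝒪_{ℂ_F}`
and `‖p‖ < 1`): the link between the `B_dR⁺`-level dévissage and Tate's theorems on `H¹(Γ_F, ℂ_F(χ^j))`.
[cite: Kato1993LNM1553, Ch. II §1.2.6–1.2.7] [cite: FontaineAsterisque223III, Exp. II §1.5.2–1.5.5] -/
theorem continuous_thetaBdR_of_uc (hp : valuation F p < 1)
    {z : absoluteGaloisGroup F → BDeRhamPlus (integerC F) p}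
    (hz : ∀ N k : ℕ, ∃ U : OpenSubgroup (absoluteGaloisGroup F), ∀ σ : absoluteGaloisGroup F, ∀ τ ∈ U,
      ∃ (a : Ainf (p := p) F) (w : BDeRhamPlus (integerC F) p),
        z (σ * τ) - z σ = ainfToBdR ((p : Ainf (p := p) F) ^ N * a) + xiBdR ^ k * w) :
    Continuous fun σ => thetaBdR (z σ) := by
  refine continuous_iff_continuousAt.2 fun σ₀ => ?_
  rw [ContinuousAt, Metric.tendsto_nhds]
  intro ε hε
  obtain ⟨N, hN⟩ := exists_pow_lt_of_lt_one hε (norm_natCast_C_lt_one hp)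
  obtain ⟨U, hU⟩ := hz N 1
  -- the coset `σ₀ U` is a neighbourhood of `σ₀`
  have hmem : {σ : absoluteGaloisGroup F | σ₀⁻¹ * σ ∈ (U : Set (absoluteGaloisGroup F))} ∈ 𝓝 σ₀ :=
    (U.isOpen.preimage (continuous_const.mul continuous_id)).mem_nhds (by simp)
  filter_upwards [hmem] with σ hσ
  obtain ⟨a, w, haw⟩ := hU σ₀ (σ₀⁻¹ * σ) hσ
  rw [mul_inv_cancel_left] at haw
  rw [dist_eq_norm, ← map_sub]
  exact (norm_thetaBdR_le_of_eq one_ne_zero haw).trans_lt hN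

end GaloisContinuity

end Literature.NumberTheory.PAdicHodge

end

/-! # Part II — the dévissage for `B_dR(F)`: `hstep`, finite type, and `kato1993_H1_bdRFil` modulo (TS1) -/

noncomputable section

open scoped TensorProduct
open ValuativeRel Field Ideal WittVector UniformSpace Topology Filter
open Literature.AlgebraicGeometry.Resolution

namespace Literature.NumberTheory.PAdicHodge

open Literature.NumberTheory.GaloisRepresentations
open Literature.NumberTheory.GaloisRepresentations.IsNonarchimedeanLocalField

namespace BdRH1Devissage

variable {F : Type} [Field F] [ValuativeRel F] [TopologicalSpace F] [IsNonarchimedeanLocalField F]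
  [CharZero F] {p : ℕ} [Fact p.Prime] [Fact (¬ IsUnit (p : integerC F))]
  [IsAdicComplete (Ideal.span {(p : integerC F)}) (integerC F)]

/-! ## §1 `Fil^N B_dR = t^N B_dR⁺`, scalars, and `σ(t^N) = χ(σ)^N t^N` -/

/-- **`Fil^N B_dR(F) = t^N · B_dR⁺(F)`** for Fontaine's `t = log[ε] = ξ · unit`.
[cite: FontaineAsterisque223III, Exp. II §1.5.5 (Fil^i B_dR = t^i B_dR⁺)] -/
theorem mem_fil_iff_tBdR_zpow (hp : valuation F p < 1) (hF : Function.Surjective (fontaineTheta (integerC F) p))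
    [IsDomain (BDeRhamPlus (integerC F) p)] (N : ℤ) (x : FracBdR F p) :
    (letI := fracAlgebra (p := p) hp hF; x ∈ fil hp hF N) ↔
      ∃ b : BDeRhamPlus (integerC F) p,
        x = algebraMap (BDeRhamPlus (integerC F) p) (FracBdR F p) tBdR ^ N *
          algebraMap (BDeRhamPlus (integerC F) p) (FracBdR F p) b := by
  obtain ⟨v, hv, htv⟩ := exists_tBdR_eq_xiBdR_mul (F := F) (p := p) hF
  have hT : algebraMap (BDeRhamPlus (integerC F) p) (FracBdR F p) tBdR =
      algebraMap (BDeRhamPlus (integerC F) p) (FracBdR F p) xiBdR *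
        algebraMap _ _ ((hv.unit : (BDeRhamPlus (integerC F) p)ˣ) : BDeRhamPlus (integerC F) p) := by
    rw [IsUnit.unit_spec, htv, map_mul]
  have h1 : algebraMap (BDeRhamPlus (integerC F) p) (FracBdR F p)
        ((hv.unit ^ N : (BDeRhamPlus (integerC F) p)ˣ) : BDeRhamPlus (integerC F) p) *
      algebraMap (BDeRhamPlus (integerC F) p) (FracBdR F p)
        (((hv.unit ^ N)⁻¹ : (BDeRhamPlus (integerC F) p)ˣ) : BDeRhamPlus (integerC F) p) = 1 := by
    rw [← map_mul, Units.mul_inv, map_one]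
  rw [mem_fil_iff hp hF, hT, mul_zpow, ← algebraMap_units_zpow]
  constructor
  · rintro ⟨b, rfl⟩
    refine ⟨(((hv.unit ^ N)⁻¹ : (BDeRhamPlus (integerC F) p)ˣ) : BDeRhamPlus (integerC F) p) * b, ?_⟩
    rw [map_mul, mul_assoc, ← mul_assoc (algebraMap (BDeRhamPlus (integerC F) p) (FracBdR F p)
      ((hv.unit ^ N : (BDeRhamPlus (integerC F) p)ˣ) : BDeRhamPlus (integerC F) p)), h1, one_mul]
  · rintro ⟨b, rfl⟩
    exact ⟨(hv.unit ^ N : (BDeRhamPlus (integerC F) p)ˣ) * b, by rw [map_mul, mul_assoc]⟩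

/-- `F ↪ B_dR⁺` restricted to `ℚ_p ⊆ F` is `qpToBdR`. [cite: FontaineAsterisque223III, Exp. II §1.5.3] -/
theorem embBdRHom_padicRingHom (hp : valuation F p < 1) (hF : Function.Surjective (fontaineTheta (integerC F) p))
    (q : ℚ_[p]) : embBdRHom hp hF (LocalField.padicRingHom F p hp q) = qpToBdR q := by
  have h := embBdRHom_algebraMap hp hF ((PadicBase.toPadic hp).symm q)
  rw [PadicBase.algebraMap_eq, PadicBase.emb_apply, RingEquiv.apply_symm_apply] at h
  exact h

/-- For ANY `ℚ_p`-algebra structure on `F` (rigidity `LocalField.ringHom_padic_ext`): `F ↪ B_dR⁺` restricted to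
`ℚ_p` is `qpToBdR`. [cite: FontaineAsterisque223III, Exp. II §1.5.3] -/
theorem embBdRHom_algebraMap_padic (hp : valuation F p < 1) (hF : Function.Surjective (fontaineTheta (integerC F) p))
    [Algebra ℚ_[p] F] (q : ℚ_[p]) : embBdRHom hp hF (algebraMap ℚ_[p] F q) = qpToBdR q := by
  rw [RingHom.congr_fun (LocalField.ringHom_padic_ext (algebraMap ℚ_[p] F) (LocalField.padicRingHom F p hp)) q,
    embBdRHom_padicRingHom]

/-- **`σ(t^N) = χ(σ)^N · t^N`** in `B_dR(F)` (`N ∈ ℤ`). [cite: FontaineAsterisque223III, Exp. II §1.5.4–1.5.5] -/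
theorem smul_tBdR_zpow [IsDomain (BDeRhamPlus (integerC F) p)] (σ : absoluteGaloisGroup F) (N : ℤ) :
    σ • algebraMap (BDeRhamPlus (integerC F) p) (FracBdR F p) tBdR ^ N =
      algebraMap (BDeRhamPlus (integerC F) p) (FracBdR F p)
        (qpToBdR (((GaloisRep.cyclotomicCharacter F p σ ^ N : ℤ_[p]ˣ) : ℤ_[p]) : ℚ_[p])) *
        algebraMap (BDeRhamPlus (integerC F) p) (FracBdR F p) tBdR ^ N := by
  rw [smul_fracBdR_eq_toRingHom σ, map_zpow₀, ← smul_fracBdR_eq_toRingHom, smul_algebraMap_fracBdR,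
    galBdRPlus_tBdR, map_mul, mul_zpow]
  congr 1
  exact (ringHom_units_zpow ((algebraMap (BDeRhamPlus (integerC F) p) (FracBdR F p)).comp
    (qpToBdR.comp (PadicInt.Coe.ringHom (p := p)))) (GaloisRep.cyclotomicCharacter F p σ) N).symm

/-- `t ≠ 0` in `B_dR(F)`. [folklore] -/
private theorem algebraMap_tBdR_ne_zero [IsDomain (BDeRhamPlus (integerC F) p)]
    (hF : Function.Surjective (fontaineTheta (integerC F) p)) :
    algebraMap (BDeRhamPlus (integerC F) p) (FracBdR F p) tBdR ≠ 0 :=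
  (map_ne_zero_iff _ algebraMap_fracBdR_injective).2 (tBdR_ne_zero hF)

/-- **`σ(t^N y₀) − t^N y₀ = t^N (χ(σ)^N σ(y₀) − y₀)`.** [cite: Kato1993LNM1553, Ch. II §1.2.5–1.2.7] -/
theorem smul_sub_eq_tBdR_zpow_mul [IsDomain (BDeRhamPlus (integerC F) p)] (σ : absoluteGaloisGroup F) (N : ℤ)
    (y₀ : BDeRhamPlus (integerC F) p) :
    σ • (algebraMap (BDeRhamPlus (integerC F) p) (FracBdR F p) tBdR ^ N *
        algebraMap (BDeRhamPlus (integerC F) p) (FracBdR F p) y₀) -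
      algebraMap (BDeRhamPlus (integerC F) p) (FracBdR F p) tBdR ^ N *
        algebraMap (BDeRhamPlus (integerC F) p) (FracBdR F p) y₀ =
      algebraMap (BDeRhamPlus (integerC F) p) (FracBdR F p) tBdR ^ N *
        algebraMap (BDeRhamPlus (integerC F) p) (FracBdR F p)
          (qpToBdR (((GaloisRep.cyclotomicCharacter F p σ ^ N : ℤ_[p]ˣ) : ℤ_[p]) : ℚ_[p]) * galBdRPlus σ y₀ - y₀) := by
  rw [smul_mul', smul_tBdR_zpow, smul_algebraMap_fracBdR, map_sub, map_mul]
  ring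

omit [ValuativeRel F] [TopologicalSpace F] [IsNonarchimedeanLocalField F] [CharZero F]
  [Fact (¬ IsUnit (p : integerC F))] [IsAdicComplete (Ideal.span {(p : integerC F)}) (integerC F)] in
/-- `σ ↦ χ(σ)^N ∈ ℚ_p` is continuous. [folklore] -/
private theorem continuous_cyclotomicCharacter_zpow_coe (N : ℤ) :
    Continuous fun σ : absoluteGaloisGroup F =>
      (((GaloisRep.cyclotomicCharacter F p σ ^ N : ℤ_[p]ˣ) : ℤ_[p]) : ℚ_[p]) := by
  have h1 : Continuous fun σ : absoluteGaloisGroup F => (GaloisRep.cyclotomicCharacter F p σ : ℤ_[p]ˣ) :=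
    (GaloisRep.cyclotomicCharacter F p).continuous
  have h2 : Continuous fun σ : absoluteGaloisGroup F => (GaloisRep.cyclotomicCharacter F p σ ^ N : ℤ_[p]ˣ) :=
    h1.zpow N
  have h3 : Continuous (fun u : ℤ_[p]ˣ => (u : ℤ_[p])) := Units.continuous_val
  have h4 : Continuous ((↑) : ℤ_[p] → ℚ_[p]) := continuous_subtype_val
  exact h4.comp (h3.comp h2)

/-! ## §2 `hstep`: the continuity predicate passes through the corrections -/

/-- **Continuity of the correction term `σ ↦ χ(σ)^N σ(y₀) − y₀`.** [cite: Kato1993LNM1553, Ch. II §1.2.5–1.2.7] -/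
theorem uc_correction (N : ℤ) (y₀ : BDeRhamPlus (integerC F) p) :
    ∀ n k : ℕ, ∃ U : OpenSubgroup (absoluteGaloisGroup F), ∀ σ : absoluteGaloisGroup F, ∀ τ ∈ U,
      ∃ (a : Ainf (p := p) F) (w : BDeRhamPlus (integerC F) p),
        (qpToBdR (((GaloisRep.cyclotomicCharacter F p (σ * τ) ^ N : ℤ_[p]ˣ) : ℤ_[p]) : ℚ_[p]) *
            galBdRPlus (σ * τ) y₀ - y₀) -
          (qpToBdR (((GaloisRep.cyclotomicCharacter F p σ ^ N : ℤ_[p]ˣ) : ℤ_[p]) : ℚ_[p]) *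
            galBdRPlus σ y₀ - y₀) =
          ainfToBdR ((p : Ainf (p := p) F) ^ n * a) + xiBdR ^ k * w :=
  GaloisContinuity.uc_sub
    (GaloisContinuity.uc_qpToBdR_mul (continuous_cyclotomicCharacter_zpow_coe N)
      (GaloisContinuity.uc_galBdRPlus y₀) (GaloisContinuity.bounded_galBdRPlus y₀))
    (GaloisContinuity.uc_const y₀)

/-- **Continuity of the scalar term `σ ↦ log χ(σ) · b`** (`log χ` continuous, `b ∈ B_dR⁺` fixed).
[cite: Kato1993LNM1553, Ch. II §1.2.2 and §1.2.5] -/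
theorem uc_logCyclotomic_mul (b : BDeRhamPlus (integerC F) p) :
    ∀ n k : ℕ, ∃ U : OpenSubgroup (absoluteGaloisGroup F), ∀ σ : absoluteGaloisGroup F, ∀ τ ∈ U,
      ∃ (a : Ainf (p := p) F) (w : BDeRhamPlus (integerC F) p),
        qpToBdR (logCyclotomic p (σ * τ)) * b - qpToBdR (logCyclotomic p σ) * b =
          ainfToBdR ((p : Ainf (p := p) F) ^ n * a) + xiBdR ^ k * w :=
  GaloisContinuity.uc_qpToBdR_mul (y := fun _ => b) (TateSen.continuous_logCyclotomic p)
    (GaloisContinuity.uc_const b) fun k => by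
      obtain ⟨r, a, w, h⟩ := GaloisContinuity.exists_natCast_pow_mul_eq_ainfToBdR_add b k
      exact ⟨r, fun _ => ⟨a, w, h⟩⟩

/-- A scalar `embBdRHom(e)`, `e ∈ F`, lying in `Fil¹` vanishes. [cite: FontaineAsterisque223III, Exp. II §1.5.5 (F ∩ Fil¹ = 0)] -/
theorem embBdRHom_eq_zero_of_mem_fil_one (hp : valuation F p < 1) (hF : Function.Surjective (fontaineTheta (integerC F) p))
    [IsDomain (BDeRhamPlus (integerC F) p)] {e : F}
    (he : letI := fracAlgebra (p := p) hp hF;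
      algebraMap (BDeRhamPlus (integerC F) p) (FracBdR F p) (embBdRHom hp hF e) ∈ fil hp hF 1) :
    embBdRHom hp hF e = 0 := by
  have h1 : thetaBdR (embBdRHom hp hF e) = 0 :=
    thetaBdR_eq_zero_of_mem_span (BdRTateGraded.mem_span_of_algebraMap_mem_fil_one hp hF he)
  rw [thetaBdR_embBdRHom, map_eq_zero_iff _ (algebraMap F (CompletedAlgClosure F)).injective] at h1
  rw [h1, map_zero]

/-- **The scalar term `log χ(σ) · a` as `t^N r(σ)` with `r` continuous** (`N ≤ 0`: `r = t^{-N} log χ · ã`;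
for `N ≥ 1` the hypothesis forces the scalar term to vanish and `r = 0`). [cite: Kato1993LNM1553, Ch. II §1.2.5–1.2.7] -/
theorem exists_scalar_lift (hF : Function.Surjective (fontaineTheta (integerC F) p))
    [IsDomain (BDeRhamPlus (integerC F) p)] (N : ℤ) (e : BDeRhamPlus (integerC F) p)
    (g : absoluteGaloisGroup F → ℚ_[p]) (hg : Continuous g) (he : 1 ≤ N → ∀ σ, qpToBdR (g σ) * e = 0) :
    ∃ r : absoluteGaloisGroup F → BDeRhamPlus (integerC F) p,
      (∀ n k : ℕ, ∃ U : OpenSubgroup (absoluteGaloisGroup F), ∀ σ : absoluteGaloisGroup F, ∀ τ ∈ U,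
        ∃ (a : Ainf (p := p) F) (w : BDeRhamPlus (integerC F) p),
          r (σ * τ) - r σ = ainfToBdR ((p : Ainf (p := p) F) ^ n * a) + xiBdR ^ k * w) ∧
      ∀ σ, algebraMap (BDeRhamPlus (integerC F) p) (FracBdR F p) (qpToBdR (g σ) * e) =
        algebraMap (BDeRhamPlus (integerC F) p) (FracBdR F p) tBdR ^ N *
          algebraMap (BDeRhamPlus (integerC F) p) (FracBdR F p) (r σ) := by
  have hT0 : algebraMap (BDeRhamPlus (integerC F) p) (FracBdR F p) tBdR ≠ 0 := algebraMap_tBdR_ne_zero hF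
  by_cases hN : N ≤ 0
  · obtain ⟨M, hM⟩ : ∃ M : ℕ, N = -(M : ℤ) := ⟨(-N).toNat, by rw [Int.toNat_of_nonneg (by omega)]; ring⟩
    refine ⟨fun σ => qpToBdR (g σ) * (tBdR ^ M * e), ?_, fun σ => ?_⟩
    · exact GaloisContinuity.uc_qpToBdR_mul (y := fun _ => tBdR ^ M * e) hg
        (GaloisContinuity.uc_const _) fun k => by
          obtain ⟨r, a, w, h⟩ := GaloisContinuity.exists_natCast_pow_mul_eq_ainfToBdR_add (tBdR ^ M * e) k
          exact ⟨r, fun _ => ⟨a, w, h⟩⟩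
    · have hTM : algebraMap (BDeRhamPlus (integerC F) p) (FracBdR F p) tBdR ^ N *
          algebraMap (BDeRhamPlus (integerC F) p) (FracBdR F p) tBdR ^ M = 1 := by
        rw [hM, zpow_neg, zpow_natCast, inv_mul_cancel₀ (pow_ne_zero _ hT0)]
      calc algebraMap (BDeRhamPlus (integerC F) p) (FracBdR F p) (qpToBdR (g σ) * e)
          = (algebraMap (BDeRhamPlus (integerC F) p) (FracBdR F p) tBdR ^ N *
              algebraMap (BDeRhamPlus (integerC F) p) (FracBdR F p) tBdR ^ M) *
            algebraMap (BDeRhamPlus (integerC F) p) (FracBdR F p) (qpToBdR (g σ) * e) := by rw [hTM, one_mul]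
        _ = _ := by simp only [map_mul, map_pow]; ring
  · refine ⟨fun _ => 0, GaloisContinuity.uc_const 0, fun σ => ?_⟩
    rw [he (by omega) σ, map_zero, mul_zero]

/-- The scalar `log χ(σ) · a` of the dévissage vanishes when the corrected cocycle lies in `Fil^{N+1}`, `N ≥ 1`
(`F ∩ Fil¹ = 0`). [cite: Kato1993LNM1553, Ch. II §1.2.7] -/
theorem scalar_eq_zero_of_mem_fil (hp : valuation F p < 1) (hF : Function.Surjective (fontaineTheta (integerC F) p))
    [IsDomain (BDeRhamPlus (integerC F) p)] [Algebra ℚ_[p] F] {N : ℤ} (hN : 1 ≤ N) {x : FracBdR F p} {q : ℚ_[p]} {a : F}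
    (hx : letI := fracAlgebra (p := p) hp hF; x ∈ fil hp hF N)
    (h : letI := fracAlgebra (p := p) hp hF;
      x - algebraMap (BDeRhamPlus (integerC F) p) (FracBdR F p) (embBdRHom hp hF (algebraMap ℚ_[p] F q)) *
          algebraMap (BDeRhamPlus (integerC F) p) (FracBdR F p) (embBdRHom hp hF a) ∈ fil hp hF (N + 1)) :
    qpToBdR q * embBdRHom hp hF a = 0 := by
  letI := fracAlgebra (p := p) hp hF
  have h1 : algebraMap (BDeRhamPlus (integerC F) p) (FracBdR F p)
      (embBdRHom hp hF (algebraMap ℚ_[p] F q * a)) ∈ fil hp hF 1 := by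
    have h2 := Submodule.sub_mem _ (fil_antitone hp hF hN hx) (fil_antitone hp hF (by omega) h)
    rwa [sub_sub_cancel, ← map_mul, ← map_mul] at h2
  have h3 := embBdRHom_eq_zero_of_mem_fil_one hp hF h1
  rwa [map_mul, embBdRHom_algebraMap_padic] at h3

/-- **`hstep` for `B_dR(F)`.** If `c = t^N z` with `z : Γ_F → B_dR⁺` continuous, `y ∈ Fil^N`, `a ∈ F`, and
`c' := c − ∂y − log χ · a` takes values in `Fil^{N+1}`, then `c' = t^{N+1} z'` with `z'` continuous:
`t^{-N} c'(σ) = z(σ) − (χ(σ)^N σ y₀ − y₀) − t^{-N} log χ(σ) a` is continuous (for `N ≥ 1` the scalar term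
vanishes), takes values in `t B_dR⁺`, and division by `t` preserves continuity. The scalar `log χ(σ) ∈ ℚ_p`
enters through `ℚ_p → F ↪ B_dR⁺` for an arbitrary `ℚ_p`-algebra structure on `F`.
[cite: Kato1993LNM1553, Ch. II §1.2.5–1.2.7] -/
theorem hstep (hp : valuation F p < 1) (hF : Function.Surjective (fontaineTheta (integerC F) p))
    [IsDomain (BDeRhamPlus (integerC F) p)] [Algebra ℚ_[p] F] (N : ℤ)
    (c : absoluteGaloisGroup F → FracBdR F p) (y : FracBdR F p) (a : F)
    (hcts : ∃ z : absoluteGaloisGroup F → BDeRhamPlus (integerC F) p,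
      (∀ n k : ℕ, ∃ U : OpenSubgroup (absoluteGaloisGroup F), ∀ σ : absoluteGaloisGroup F, ∀ τ ∈ U,
        ∃ (a : Ainf (p := p) F) (w : BDeRhamPlus (integerC F) p),
          z (σ * τ) - z σ = ainfToBdR ((p : Ainf (p := p) F) ^ n * a) + xiBdR ^ k * w) ∧
      ∀ σ, c σ = algebraMap (BDeRhamPlus (integerC F) p) (FracBdR F p) tBdR ^ N *
        algebraMap (BDeRhamPlus (integerC F) p) (FracBdR F p) (z σ))
    (hy : letI := fracAlgebra (p := p) hp hF; y ∈ fil hp hF N)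
    (h : ∀ σ, letI := fracAlgebra (p := p) hp hF;
      c σ - (σ • y - y) -
        algebraMap (BDeRhamPlus (integerC F) p) (FracBdR F p) (embBdRHom hp hF (algebraMap ℚ_[p] F (logCyclotomic p σ))) *
          algebraMap (BDeRhamPlus (integerC F) p) (FracBdR F p) (embBdRHom hp hF a) ∈ fil hp hF (N + 1)) :
    ∃ z' : absoluteGaloisGroup F → BDeRhamPlus (integerC F) p,
      (∀ n k : ℕ, ∃ U : OpenSubgroup (absoluteGaloisGroup F), ∀ σ : absoluteGaloisGroup F, ∀ τ ∈ U,
        ∃ (a : Ainf (p := p) F) (w : BDeRhamPlus (integerC F) p),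
          z' (σ * τ) - z' σ = ainfToBdR ((p : Ainf (p := p) F) ^ n * a) + xiBdR ^ k * w) ∧
      ∀ σ, c σ - (σ • y - y) -
          algebraMap (BDeRhamPlus (integerC F) p) (FracBdR F p) (embBdRHom hp hF (algebraMap ℚ_[p] F (logCyclotomic p σ))) *
            algebraMap (BDeRhamPlus (integerC F) p) (FracBdR F p) (embBdRHom hp hF a) =
        algebraMap (BDeRhamPlus (integerC F) p) (FracBdR F p) tBdR ^ (N + 1) *
          algebraMap (BDeRhamPlus (integerC F) p) (FracBdR F p) (z' σ) := by
  have hT0 : algebraMap (BDeRhamPlus (integerC F) p) (FracBdR F p) tBdR ≠ 0 := algebraMap_tBdR_ne_zero hF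
  obtain ⟨z, hz, hcz⟩ := hcts
  obtain ⟨y₀, rfl⟩ := (mem_fil_iff_tBdR_zpow hp hF N y).1 hy
  -- `c − ∂y ∈ Fil^N`
  have hcy : ∀ σ, letI := fracAlgebra (p := p) hp hF;
      c σ - (σ • (algebraMap (BDeRhamPlus (integerC F) p) (FracBdR F p) tBdR ^ N *
        algebraMap (BDeRhamPlus (integerC F) p) (FracBdR F p) y₀) -
        algebraMap (BDeRhamPlus (integerC F) p) (FracBdR F p) tBdR ^ N *
          algebraMap (BDeRhamPlus (integerC F) p) (FracBdR F p) y₀) ∈ fil hp hF N := by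
    intro σ
    letI := fracAlgebra (p := p) hp hF
    refine Submodule.sub_mem _ ?_ (Submodule.sub_mem _ (smul_mem_fil hp hF σ _ _ hy) hy)
    rw [hcz σ]
    exact (mem_fil_iff_tBdR_zpow hp hF N _).2 ⟨z σ, rfl⟩
  -- the scalar term as `t^N r(σ)` with `r` continuous (vanishing for `N ≥ 1`)
  have he : 1 ≤ N → ∀ σ, qpToBdR (logCyclotomic p σ) * embBdRHom hp hF a = 0 :=
    fun hN σ => scalar_eq_zero_of_mem_fil hp hF hN (hcy σ) (h σ)
  obtain ⟨r, hr_uc, hr⟩ := exists_scalar_lift hF N (embBdRHom hp hF a) (logCyclotomic p)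
    (TateSen.continuous_logCyclotomic p) he
  have hsc : ∀ σ, algebraMap (BDeRhamPlus (integerC F) p) (FracBdR F p)
        (embBdRHom hp hF (algebraMap ℚ_[p] F (logCyclotomic p σ))) *
      algebraMap (BDeRhamPlus (integerC F) p) (FracBdR F p) (embBdRHom hp hF a) =
        algebraMap (BDeRhamPlus (integerC F) p) (FracBdR F p) tBdR ^ N *
          algebraMap (BDeRhamPlus (integerC F) p) (FracBdR F p) (r σ) := by
    intro σ
    rw [embBdRHom_algebraMap_padic, ← map_mul, hr σ]
  -- `w := z − (χ^N σ y₀ − y₀) − r` is continuous and `t^N w = c'`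
  obtain ⟨w, hw⟩ : ∃ w : absoluteGaloisGroup F → BDeRhamPlus (integerC F) p, ∀ σ,
      w σ = z σ - (qpToBdR (((GaloisRep.cyclotomicCharacter F p σ ^ N : ℤ_[p]ˣ) : ℤ_[p]) : ℚ_[p]) *
        galBdRPlus σ y₀ - y₀) - r σ := ⟨_, fun σ => rfl⟩
  have hw_uc : ∀ n k : ℕ, ∃ U : OpenSubgroup (absoluteGaloisGroup F), ∀ σ : absoluteGaloisGroup F, ∀ τ ∈ U,
      ∃ (a : Ainf (p := p) F) (v : BDeRhamPlus (integerC F) p),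
        w (σ * τ) - w σ = ainfToBdR ((p : Ainf (p := p) F) ^ n * a) + xiBdR ^ k * v := by
    have h1 := GaloisContinuity.uc_sub (GaloisContinuity.uc_sub hz (uc_correction N y₀)) hr_uc
    simpa only [hw] using h1
  have hcw : ∀ σ, c σ - (σ • (algebraMap (BDeRhamPlus (integerC F) p) (FracBdR F p) tBdR ^ N *
        algebraMap (BDeRhamPlus (integerC F) p) (FracBdR F p) y₀) -
        algebraMap (BDeRhamPlus (integerC F) p) (FracBdR F p) tBdR ^ N *
          algebraMap (BDeRhamPlus (integerC F) p) (FracBdR F p) y₀) -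
      algebraMap (BDeRhamPlus (integerC F) p) (FracBdR F p)
          (embBdRHom hp hF (algebraMap ℚ_[p] F (logCyclotomic p σ))) *
        algebraMap (BDeRhamPlus (integerC F) p) (FracBdR F p) (embBdRHom hp hF a) =
      algebraMap (BDeRhamPlus (integerC F) p) (FracBdR F p) tBdR ^ N *
        algebraMap (BDeRhamPlus (integerC F) p) (FracBdR F p) (w σ) := by
    intro σ
    rw [hsc, hcz, smul_sub_eq_tBdR_zpow_mul (F := F) (p := p) σ N y₀, hw]
    simp only [map_sub]
    ring
  -- values in `Fil^{N+1}` force `w σ ∈ t B_dR⁺`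
  have hwt : ∀ σ, ∃ b : BDeRhamPlus (integerC F) p, w σ = tBdR * b := by
    intro σ
    have h1 := h σ
    rw [hcw σ] at h1
    obtain ⟨b, hb⟩ := (mem_fil_iff_tBdR_zpow hp hF (N + 1) _).1 h1
    refine ⟨b, algebraMap_fracBdR_injective (F := F) (p := p) ?_⟩
    rw [map_mul]
    apply mul_left_cancel₀ (zpow_ne_zero N hT0)
    rw [hb, zpow_add_one₀ hT0, mul_assoc]
  choose z' hz' using hwt
  refine ⟨z', GaloisContinuity.uc_of_tBdR_mul hF hw_uc hz', fun σ => ?_⟩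
  rw [hcw σ, hz', map_mul, zpow_add_one₀ hT0]
  ring

/-! ## §3 Cocycles of finite type; the `u`-normal form for the graded steps; the graded steps -/

/-- **A cochain of finite type `Σ_j f_j(σ) β_j` (`β_j ∈ Fil^m`, `f_j` continuous) is `t^m z` with `z`
continuous** (scalars through `ℚ_p → F ↪ B_dR⁺`). [cite: Kato1993LNM1553, Ch. II §1.2.5–1.2.7] -/
theorem cts_of_finite_type (hp : valuation F p < 1) (hF : Function.Surjective (fontaineTheta (integerC F) p))
    [IsDomain (BDeRhamPlus (integerC F) p)] [Algebra ℚ_[p] F] (m : ℤ) {ι : Type} [Fintype ι]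
    (β : ι → FracBdR F p) (f : ι → C(absoluteGaloisGroup F, ℚ_[p]))
    (hβ : ∀ j, letI := fracAlgebra (p := p) hp hF; β j ∈ fil hp hF m) :
    ∃ z : absoluteGaloisGroup F → BDeRhamPlus (integerC F) p,
      (∀ n k : ℕ, ∃ U : OpenSubgroup (absoluteGaloisGroup F), ∀ σ : absoluteGaloisGroup F, ∀ τ ∈ U,
        ∃ (a : Ainf (p := p) F) (w : BDeRhamPlus (integerC F) p),
          z (σ * τ) - z σ = ainfToBdR ((p : Ainf (p := p) F) ^ n * a) + xiBdR ^ k * w) ∧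
      ∀ σ, (∑ j, algebraMap (BDeRhamPlus (integerC F) p) (FracBdR F p)
          (embBdRHom hp hF (algebraMap ℚ_[p] F (f j σ))) * β j) =
        algebraMap (BDeRhamPlus (integerC F) p) (FracBdR F p) tBdR ^ m *
          algebraMap (BDeRhamPlus (integerC F) p) (FracBdR F p) (z σ) := by
  classical
  choose b hb using fun j => (mem_fil_iff_tBdR_zpow hp hF m (β j)).1 (hβ j)
  refine ⟨fun σ => ∑ j, qpToBdR (f j σ) * b j, ?_, fun σ => ?_⟩
  · refine GaloisContinuity.uc_sum (z := fun j σ => qpToBdR (f j σ) * b j) Finset.univ fun j _ => ?_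
    exact GaloisContinuity.uc_qpToBdR_mul (y := fun _ => b j) (f j).continuous
      (GaloisContinuity.uc_const (b j)) fun k => by
        obtain ⟨r, a, w, h⟩ := GaloisContinuity.exists_natCast_pow_mul_eq_ainfToBdR_add (b j) k
        exact ⟨r, fun _ => ⟨a, w, h⟩⟩
  · rw [map_sum, Finset.mul_sum]
    refine Finset.sum_congr rfl fun j _ => ?_
    rw [embBdRHom_algebraMap_padic, hb j, map_mul]
    ring

/-- **From `t^N z` to Fontaine's `u^N z_u`** with `θ ∘ z_u` continuous (`t = u · unit`): the input form of the
tree's graded steps (`BdRDevissageInputs`). [cite: FontaineAsterisque223III, Exp. II §1.5.4–1.5.5] -/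
theorem exists_unif_form (hp : valuation F p < 1) (hF : Function.Surjective (fontaineTheta (integerC F) p))
    [IsDomain (BDeRhamPlus (integerC F) p)] (N : ℤ) (c : absoluteGaloisGroup F → FracBdR F p)
    (hcts : ∃ z : absoluteGaloisGroup F → BDeRhamPlus (integerC F) p,
      (∀ n k : ℕ, ∃ U : OpenSubgroup (absoluteGaloisGroup F), ∀ σ : absoluteGaloisGroup F, ∀ τ ∈ U,
        ∃ (a : Ainf (p := p) F) (w : BDeRhamPlus (integerC F) p),
          z (σ * τ) - z σ = ainfToBdR ((p : Ainf (p := p) F) ^ n * a) + xiBdR ^ k * w) ∧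
      ∀ σ, c σ = algebraMap (BDeRhamPlus (integerC F) p) (FracBdR F p) tBdR ^ N *
        algebraMap (BDeRhamPlus (integerC F) p) (FracBdR F p) (z σ)) :
    ∃ zu : absoluteGaloisGroup F → BDeRhamPlus (integerC F) p,
      (∀ σ, c σ = algebraMap (BDeRhamPlus (integerC F) p) (FracBdR F p) uBdR ^ N *
        algebraMap (BDeRhamPlus (integerC F) p) (FracBdR F p) (zu σ)) ∧
      Continuous fun σ => thetaBdR (zu σ) := by
  obtain ⟨z, hz, hcz⟩ := hcts
  obtain ⟨v, hv, htv⟩ := exists_tBdR_eq_uBdR_mul (F := F) (p := p) hF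
  refine ⟨fun σ => ((hv.unit ^ N : (BDeRhamPlus (integerC F) p)ˣ) : BDeRhamPlus (integerC F) p) * z σ,
    fun σ => ?_, ?_⟩
  · rw [hcz σ, htv, map_mul, mul_zpow, map_mul, algebraMap_units_zpow, IsUnit.unit_spec]
    ring
  · have h1 : (fun σ => thetaBdR (((hv.unit ^ N : (BDeRhamPlus (integerC F) p)ˣ) : BDeRhamPlus (integerC F) p) * z σ)) =
        fun σ => thetaBdR ((hv.unit ^ N : (BDeRhamPlus (integerC F) p)ˣ) : BDeRhamPlus (integerC F) p) * thetaBdR (z σ) :=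
      funext fun σ => map_mul _ _ _
    rw [h1]
    exact continuous_const.mul (GaloisContinuity.continuous_thetaBdR_of_uc hp hz)

/-- **Graded step `N ≠ 0`** for `Cts`-cocycles (Tate's `H¹(Γ_F, ℂ_F(χ^N)) = 0`, modulo (TS1); tree
`BdRTateGraded.exists_sub_coboundary_mem_fil_succ`). [cite: Kato1993LNM1553, Ch. II §1.2.7] [cite: Tate1967, §3.3 Theorem 2] -/
theorem hgrne (hp : valuation F p < 1) (hF : Function.Surjective (fontaineTheta (integerC F) p))
    [IsDomain (BDeRhamPlus (integerC F) p)] (hTS1 : tate1967_TS1_completedAlgClosure) {N : ℤ} (hN : N ≠ 0)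
    (c : absoluteGaloisGroup F → FracBdR F p) (hc : ∀ σ τ : absoluteGaloisGroup F, c (σ * τ) = c σ + σ • c τ)
    (hcts : ∃ z : absoluteGaloisGroup F → BDeRhamPlus (integerC F) p,
      (∀ n k : ℕ, ∃ U : OpenSubgroup (absoluteGaloisGroup F), ∀ σ : absoluteGaloisGroup F, ∀ τ ∈ U,
        ∃ (a : Ainf (p := p) F) (w : BDeRhamPlus (integerC F) p),
          z (σ * τ) - z σ = ainfToBdR ((p : Ainf (p := p) F) ^ n * a) + xiBdR ^ k * w) ∧
      ∀ σ, c σ = algebraMap (BDeRhamPlus (integerC F) p) (FracBdR F p) tBdR ^ N *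
        algebraMap (BDeRhamPlus (integerC F) p) (FracBdR F p) (z σ)) :
    ∃ y, (letI := fracAlgebra (p := p) hp hF; y ∈ fil hp hF N) ∧
      ∀ σ, letI := fracAlgebra (p := p) hp hF; c σ - (σ • y - y) ∈ fil hp hF (N + 1) := by
  obtain ⟨zu, hzu, hcont⟩ := exists_unif_form hp hF N c hcts
  exact BdRTateGraded.exists_sub_coboundary_mem_fil_succ hp hF hTS1 hN c hc zu hzu hcont

/-- **Graded step `N = 0`** for `Cts`-cocycles (Tate's `H¹(Γ_F, ℂ_F) = F · log χ_F`, modulo (TS1); tree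
`BdRTateGraded.exists_sub_coboundary_sub_log_mem_fil_one`), with the scalar `log χ(σ)` entering through an
arbitrary `ℚ_p`-algebra structure on `F`. [cite: Kato1993LNM1553, Ch. II §1.2.7] [cite: Tate1967, §3.3 Theorem 1] -/
theorem hgrz (hp : valuation F p < 1) (hF : Function.Surjective (fontaineTheta (integerC F) p))
    [IsDomain (BDeRhamPlus (integerC F) p)] [Algebra ℚ_[p] F] (hTS1 : tate1967_TS1_completedAlgClosure)
    (c : absoluteGaloisGroup F → FracBdR F p) (hc : ∀ σ τ : absoluteGaloisGroup F, c (σ * τ) = c σ + σ • c τ)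
    (hcts : ∃ z : absoluteGaloisGroup F → BDeRhamPlus (integerC F) p,
      (∀ n k : ℕ, ∃ U : OpenSubgroup (absoluteGaloisGroup F), ∀ σ : absoluteGaloisGroup F, ∀ τ ∈ U,
        ∃ (a : Ainf (p := p) F) (w : BDeRhamPlus (integerC F) p),
          z (σ * τ) - z σ = ainfToBdR ((p : Ainf (p := p) F) ^ n * a) + xiBdR ^ k * w) ∧
      ∀ σ, c σ = algebraMap (BDeRhamPlus (integerC F) p) (FracBdR F p) tBdR ^ (0 : ℤ) *
        algebraMap (BDeRhamPlus (integerC F) p) (FracBdR F p) (z σ)) :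
    ∃ y, (letI := fracAlgebra (p := p) hp hF; y ∈ fil hp hF 0) ∧ ∃ A : F,
      ∀ σ, letI := fracAlgebra (p := p) hp hF;
        c σ - (σ • y - y) -
          algebraMap (BDeRhamPlus (integerC F) p) (FracBdR F p)
              (embBdRHom hp hF (algebraMap ℚ_[p] F (logCyclotomic p σ))) *
            algebraMap (BDeRhamPlus (integerC F) p) (FracBdR F p) (embBdRHom hp hF A) ∈ fil hp hF 1 := by
  obtain ⟨zu, hzu, hcont⟩ := exists_unif_form hp hF 0 c hcts
  obtain ⟨y, hy, A, hA⟩ := BdRTateGraded.exists_sub_coboundary_sub_log_mem_fil_one hp hF hTS1 c hc zu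
    (fun σ => by rw [hzu σ, zpow_zero, one_mul]) hcont
  refine ⟨y, hy, A, fun σ => ?_⟩
  rw [RingHom.congr_fun (LocalField.ringHom_padic_ext (algebraMap ℚ_[p] F) (LocalField.padicRingHom F p hp))]
  exact hA σ

/-! ## §4 The theorem -/

/-- **Kato, LNM 1553, II §1.2.7 for `V = ℚ_p`, PROVED modulo (TS1)**: for every `p`-adic field `F`, `m ∈ ℤ`
and every `1`-cocycle of finite type `c(σ) = Σ_j f_j(σ) β_j : Γ_F → Fil^m B_dR(F)` (`f_j` continuous,
`β_j ∈ Fil^m`), `c = ∂b + log χ_cyclo · a` with `b ∈ Fil^m B_dR(F)`, `a ∈ F`, `a = 0` if `m ≥ 1` — i.e.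
`H¹(K, B^m_dR) = K · log χ` (`m ≤ 0`), `= 0` (`m ≥ 1`) on cocycles of finite type — GRANTED Tate's (TS1)
`tate1967_TS1_completedAlgClosure`. Proof: Kato's `t`-adic dévissage (`TateGraded.exists_eq_coboundary_add_of_devissage`)
with the continuity predicate `c = t^N z`, `z` continuous for Fontaine's topology on `B_dR⁺`; graded steps =
Tate's `H¹(Γ_F, ℂ_F(χ^N)) = 0` / `H¹(Γ_F, ℂ_F) = F log χ` (modulo (TS1)), completeness of `B_dR⁺`, and
`hstep` above. [cite: Kato1993LNM1553, Ch. II §1.2.5–1.2.7] [cite: Tate1967, §3.3 Theorems 1–2] -/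
theorem kato1993_H1_bdRFil_of_TS1 (hTS1 : tate1967_TS1_completedAlgClosure) : kato1993_H1_bdRFil := by
  intro F _ _ _ _ _ p _ _ _ hp _ m ι _ β f hβ hcoc
  classical
  have hF : Function.Surjective (fontaineTheta (integerC F) p) := surjective_fontaineTheta_integerC hp
  haveI : IsDomain (BDeRhamPlus (integerC F) p) := isDomain_bDeRhamPlus hF
  -- the cochain with its scalars written through `algebraMap`
  have hc_eq : ∀ σ, (∑ j, f j σ • β j) =
      ∑ j, algebraMap ℚ_[p] (bdRPeriodRingData (F := F) (p := p) hp).B (f j σ) * β j :=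
    fun σ => Finset.sum_congr rfl fun j _ => Algebra.smul_def _ _
  -- `c ∈ Fil^m`
  have hcm : ∀ σ, (∑ j, f j σ • β j) ∈ (bdRPeriodRingData (F := F) (p := p) hp).fil m := fun σ =>
    Submodule.sum_mem _ fun j _ => Submodule.smul_of_tower_mem _ (f j σ) (hβ j)
  -- the dévissage
  refine TateGraded.exists_eq_coboundary_add_of_devissage (bdRPeriodRingData (F := F) (p := p) hp) (logCyclotomic p)
    (fun N c => ∃ z : absoluteGaloisGroup F → BDeRhamPlus (integerC F) p,
      (∀ n k : ℕ, ∃ U : OpenSubgroup (absoluteGaloisGroup F), ∀ σ : absoluteGaloisGroup F, ∀ τ ∈ U,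
        ∃ (a : Ainf (p := p) F) (w : BDeRhamPlus (integerC F) p),
          z (σ * τ) - z σ = ainfToBdR ((p : Ainf (p := p) F) ^ n * a) + xiBdR ^ k * w) ∧
      ∀ σ, c σ = algebraMap (BDeRhamPlus (integerC F) p) (FracBdR F p) tBdR ^ N *
        algebraMap (BDeRhamPlus (integerC F) p) (FracBdR F p) (z σ))
    (logCyclotomic_mul p) ?_ ?_ ?_ ?_ m _ hcoc hcm ?_
  · -- hstep
    intro N c y a hcts hy hfil
    exact hstep hp hF N c y a hcts hy hfil
  · -- hgrne
    intro N hN c hc _ hcts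
    exact hgrne hp hF hTS1 hN c hc hcts
  · -- hgrz
    intro c hc _ hcts
    exact hgrz hp hF hTS1 c hc hcts
  · -- hcomplete
    intro m' y hy
    exact BdRTateGraded.exists_lim_of_mem_fil_add hp hF m' y hy
  · -- cocycles of finite type are `Cts m`
    obtain ⟨z, hz, hcz⟩ := cts_of_finite_type hp hF m β f hβ
    exact ⟨z, hz, fun σ => (hc_eq σ).trans (hcz σ)⟩

/-- **Kato II Prop. 1.2.3 (surjectivity half: every continuous cocycle of a de Rham `V` has a dual exponential)
for EVERY finite-dimensional de Rham representation, modulo (TS1) alone** — `kato1993_H1_bdRFil_of_TS1` fed into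
the tree's `hasDualExp_of_isDeRham_of_kato1993_H1_bdRFil` (filtered comparison + dévissage).
[cite: Kato1993LNM1553, Ch. II Prop. 1.2.3 and §1.2.6–1.2.7] -/
theorem hasDualExp_of_isDeRham_of_TS1 (hTS1 : tate1967_TS1_completedAlgClosure) : hasDualExp_of_isDeRham :=
  hasDualExp_of_isDeRham_of_kato1993_H1_bdRFil (kato1993_H1_bdRFil_of_TS1 hTS1)

/-- **Both halves of Kato II Prop. 1.2.3 for every de Rham `V`, modulo (TS1) alone.**
[cite: Kato1993LNM1553, Ch. II Prop. 1.2.3] -/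
theorem cupLogInjective_and_hasDualExp_of_isDeRham_of_TS1 (hTS1 : tate1967_TS1_completedAlgClosure) :
    cupLogInjective_and_hasDualExp_of_isDeRham :=
  cupLogInjective_and_hasDualExp_of_isDeRham_of_kato1993_H1_bdRFil (kato1993_H1_bdRFil_of_TS1 hTS1)

/-! ## §5 The general form: every continuous cocycle (appended) -/

/-- **Kato, LNM 1553, II §1.2.7 for `V = ℚ_p`, GENERAL continuous cocycles, modulo (TS1).** For a `p`-adic field `F`,
`m ∈ ℤ` and EVERY `1`-cocycle `c : Γ_F → Fil^m B_dR(F)` of the form `c = t^m z` with `z : Γ_F → B_dR⁺` continuous for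
Fontaine's topology (uniformly along open subgroups, lattices `p^N ι(𝔸_inf) + ξ^k B_dR⁺` — on the compact `Γ_F` this is
Kato's continuity, II §1.2.5), `c = ∂b + log χ_cyclo · a` with `b ∈ Fil^m`, `a ∈ F`, `a = 0` if `m ≥ 1`: i.e.
`H¹_cont(K, B^m_dR) = K · log χ` (`m ≤ 0`), `= 0` (`m ≥ 1`) — the statement of which `kato1993_H1_bdRFil_of_TS1` is the
finite-type case (this removes the «cocycles of finite type» restriction of the named fact `kato1993_H1_bdRFil`).
[cite: Kato1993LNM1553, Ch. II §1.2.5–1.2.7] [cite: Tate1967, §3.3 Theorems 1–2] -/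
theorem exists_eq_coboundary_add_logCyclotomic_of_TS1 (hTS1 : tate1967_TS1_completedAlgClosure)
    (hp : valuation F p < 1) [Algebra ℚ_[p] F] [IsDomain (BDeRhamPlus (integerC F) p)] (m : ℤ)
    (c : absoluteGaloisGroup F → (bdRPeriodRingData (F := F) (p := p) hp).B)
    (hc : ∀ σ τ : absoluteGaloisGroup F, c (σ * τ) = c σ + σ • c τ)
    (hcts : ∃ z : absoluteGaloisGroup F → BDeRhamPlus (integerC F) p,
      (∀ n k : ℕ, ∃ U : OpenSubgroup (absoluteGaloisGroup F), ∀ σ : absoluteGaloisGroup F, ∀ τ ∈ U,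
        ∃ (a : Ainf (p := p) F) (w : BDeRhamPlus (integerC F) p),
          z (σ * τ) - z σ = ainfToBdR ((p : Ainf (p := p) F) ^ n * a) + xiBdR ^ k * w) ∧
      ∀ σ, c σ = algebraMap (BDeRhamPlus (integerC F) p) (FracBdR F p) tBdR ^ m *
        algebraMap (BDeRhamPlus (integerC F) p) (FracBdR F p) (z σ)) :
    ∃ b ∈ (bdRPeriodRingData (F := F) (p := p) hp).fil m, ∃ a : F, (1 ≤ m → a = 0) ∧
      ∀ σ : absoluteGaloisGroup F, c σ = σ • b - b +
        algebraMap ℚ_[p] (bdRPeriodRingData (F := F) (p := p) hp).B (logCyclotomic p σ) *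
          algebraMap F (bdRPeriodRingData (F := F) (p := p) hp).B a := by
  have hF : Function.Surjective (fontaineTheta (integerC F) p) := surjective_fontaineTheta_integerC hp
  -- `c ∈ Fil^m` (the `IsDomain` instance is `isDomain_bDeRhamPlus hF`; any two agree)
  have hcm : ∀ σ, c σ ∈ (bdRPeriodRingData (F := F) (p := p) hp).fil m := by
    obtain ⟨z, -, hcz⟩ := hcts
    intro σ
    exact (mem_fil_iff_tBdR_zpow hp hF m (c σ)).2 ⟨z σ, hcz σ⟩
  refine TateGraded.exists_eq_coboundary_add_of_devissage (bdRPeriodRingData (F := F) (p := p) hp) (logCyclotomic p)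
    (fun N c => ∃ z : absoluteGaloisGroup F → BDeRhamPlus (integerC F) p,
      (∀ n k : ℕ, ∃ U : OpenSubgroup (absoluteGaloisGroup F), ∀ σ : absoluteGaloisGroup F, ∀ τ ∈ U,
        ∃ (a : Ainf (p := p) F) (w : BDeRhamPlus (integerC F) p),
          z (σ * τ) - z σ = ainfToBdR ((p : Ainf (p := p) F) ^ n * a) + xiBdR ^ k * w) ∧
      ∀ σ, c σ = algebraMap (BDeRhamPlus (integerC F) p) (FracBdR F p) tBdR ^ N *
        algebraMap (BDeRhamPlus (integerC F) p) (FracBdR F p) (z σ))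
    (logCyclotomic_mul p) ?_ ?_ ?_ ?_ m c hc hcm hcts
  · intro N c' y a hcts' hy hfil
    exact hstep hp hF N c' y a hcts' hy hfil
  · intro N hN c' hc' _ hcts'
    exact hgrne hp hF hTS1 hN c' hc' hcts'
  · intro c' hc' _ hcts'
    exact hgrz hp hF hTS1 c' hc' hcts'
  · intro m' y hy
    exact BdRTateGraded.exists_lim_of_mem_fil_add hp hF m' y hy

end BdRH1Devissage

end Literature.NumberTheory.PAdicHodge

end
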